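import Literature.Geometry.Lorentzian.KerrConvergence
import HarnessLib

/-!
# Route ClusterCompleteness · crux `OmegaLimitMultiKerr` — ω-limit glue: pointwise convergence of
# translates from `supCkENorm` convergence, and inheritance of all-time pointwise bounds (the anchor)

Structure lemmas for the crux stmt-FinalStateConjecture-14664 (`ClusterCompleteness.OmegaLimitMultiKerr`,
rank 9), line `Sketch`, lead gen 3. The ω-limit theorems of this line
(`…TranslateCompactness`, `…BackgroundOmegaLimits`) output `Cᵏ` convergence of translates in the
currency `supCkENorm K k (h (· + T n • e) − g) → 0`; consumers (vacuum closedness of the limit,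
anchor inheritance, label re-basing) want plain pointwise statements. This file provides the two
conversions used everywhere:

* `tendsto_translate_of_tendsto_supCkENorm` — at a point of `K`, the translates converge to the
  limit value (`m = 0` term of the sup norm);
* `norm_omegaLimit_le_of_eventually_norm_translate_le` — a pointwise bound `‖h (x + T n • e)‖ ≤ c`
  holding for all large `n` (e.g. the crux's all-time `C⁰` ANCHOR `1/4` on certified regions) passes
  to the ω-limit: `‖g x‖ ≤ c` (closed balls are closed). Hence anchored era charts have anchored
  ω-limits; whether `c = 1/4` also makes the limit NONDEGENERATE near a boosted horizon depends on
  the nondegeneracy margin of `boostedKerrBilin` there (which drops below `1/4` for receding speeds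
  `v ≳ 0.3`; see the line card `Lines/Sketch.md`, cycle 3) — not claimed here.
Hale 1980, Ch. I, §8 (ω-limit sets are closed and inherit closed constraints).
-/

-- every `Summit.FinalStateConjecture.FinalStateConjecture.…` name repeats the summit = sub-problem segment (D-0017 layout)
set_option linter.dupNamespace false

noncomputable section

open Set Filter Topology Function
open scoped ContDiff Topology ENNReal

namespace Summit.FinalStateConjecture.FinalStateConjecture.Theorems.ClusterCompleteness

open Literature.Geometry.Lorentzian

/-- **Pointwise convergence of the translates from `supCkENorm` convergence.** If
`supCkENorm K k (h (· + T n • e) − g) → 0` and `x ∈ K`, then `h (x + T n • e) → g x` (the order-zero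
term of the `Cᵏ` sup norm dominates the pointwise distance). (Hale 1980, Ch. I, §8.)
[cite: Hale1980, Ch. I §8] -/
theorem tendsto_translate_of_tendsto_supCkENorm :
    ∀ {E : Type*} [NormedAddCommGroup E] [NormedSpace ℝ E]
      {W : Type*} [NormedAddCommGroup W] [NormedSpace ℝ W]
      {K : Set E} {k : ℕ} {h g : E → W} {e : E} {T : ℕ → ℝ} {x : E}, x ∈ K →
      Tendsto (fun n ↦ supCkENorm K k (fun y ↦ h (y + T n • e) - g y)) atTop (𝓝 0) →
      Tendsto (fun n ↦ h (x + T n • e)) atTop (𝓝 (g x)) := by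
  intro E _ _ W _ _ K k h g e T x hx hlim
  have h3 : Tendsto (fun n ↦ ‖h (x + T n • e) - g x‖ₑ) atTop (𝓝 0) := by
    refine tendsto_of_tendsto_of_tendsto_of_le_of_le tendsto_const_nhds hlim
      (fun _ ↦ zero_le) fun n ↦ ?_
    have hle := enorm_iteratedFDeriv_le_supCkENorm (Nat.zero_le k) hx
      (fun y ↦ h (y + T n • e) - g y)
    have e0 : ‖iteratedFDeriv ℝ 0 (fun y ↦ h (y + T n • e) - g y) x‖ₑ =
        ‖h (x + T n • e) - g x‖ₑ := by
      rw [enorm_eq_nnnorm, enorm_eq_nnnorm]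
      exact congrArg _ (NNReal.eq (by simp only [coe_nnnorm, norm_iteratedFDeriv_zero]))
    exact e0 ▸ hle
  have h4 : Tendsto (fun n ↦ h (x + T n • e) - g x) atTop (𝓝 0) :=
    tendsto_zero_iff_enorm_tendsto_zero.2 h3
  exact tendsto_sub_nhds_zero_iff.1 h4

/-- **ω-limits inherit all-time pointwise bounds (anchored era charts have anchored ω-limits).**
If the translates converge at `x`, `h (x + T n • e) → g x`, and `‖h (x + T n • e)‖ ≤ c` for all
large `n`, then `‖g x‖ ≤ c` (the closed ball is closed; Hale 1980, Ch. I, §8: ω-limit sets inherit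
closed constraints). [cite: Hale1980, Ch. I §8] -/
theorem norm_omegaLimit_le_of_eventually_norm_translate_le :
    ∀ {E : Type*} [NormedAddCommGroup E] [NormedSpace ℝ E]
      {W : Type*} [NormedAddCommGroup W] [NormedSpace ℝ W]
      {h g : E → W} {e : E} {T : ℕ → ℝ} {x : E} {c : ℝ},
      Tendsto (fun n ↦ h (x + T n • e)) atTop (𝓝 (g x)) →
      (∀ᶠ n in atTop, ‖h (x + T n • e)‖ ≤ c) → ‖g x‖ ≤ c := by
  intro E _ _ W _ _ h g e T x c hlim hb
  exact le_of_tendsto hlim.norm hb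

/-- **Combined form over a set**: if the translates converge in `supCkENorm K k` to `g` and are
eventually bounded by `c` pointwise on `K`, then `‖g x‖ ≤ c` on `K`. [cite: Hale1980, Ch. I §8] -/
theorem norm_omegaLimit_le_of_tendsto_supCkENorm :
    ∀ {E : Type*} [NormedAddCommGroup E] [NormedSpace ℝ E]
      {W : Type*} [NormedAddCommGroup W] [NormedSpace ℝ W]
      {K : Set E} {k : ℕ} {h g : E → W} {e : E} {T : ℕ → ℝ} {c : ℝ},
      Tendsto (fun n ↦ supCkENorm K k (fun y ↦ h (y + T n • e) - g y)) atTop (𝓝 0) →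
      (∀ᶠ n in atTop, ∀ x ∈ K, ‖h (x + T n • e)‖ ≤ c) → ∀ x ∈ K, ‖g x‖ ≤ c := by
  intro E _ _ W _ _ K k h g e T c hlim hb x hx
  exact norm_omegaLimit_le_of_eventually_norm_translate_le
    (tendsto_translate_of_tendsto_supCkENorm hx hlim) (hb.mono fun n hn ↦ hn x hx)

end Summit.FinalStateConjecture.FinalStateConjecture.Theorems.ClusterCompleteness

end
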